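import Summits.Ventures.PercRepro2.CaseOneStarCertT1
import Summits.Ventures.PercRepro2.CaseOneGadgetUWA1OBlockIQ0
import Summits.Ventures.PercRepro2.CaseOneGadgetUWA1OBlockIQ1
import Summits.Ventures.PercRepro2.CaseOneGadgetUWA1OBlockIQ2
import Summits.Ventures.PercRepro2.CaseOneGadgetUWA1OBlockIQ3
import Summits.Ventures.PercRepro2.CaseOneGadgetUWA1OBlockIQ4
import Summits.Ventures.PercRepro2.CaseOneGadgetUWA1OBlockIQ5
import Summits.Ventures.PercRepro2.CaseOneGadgetUWA1OBlockIQ6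
import Summits.Ventures.PercRepro2.CaseOneGadgetUWA1OBlockIQ7
import Summits.Ventures.PercRepro2.CaseOneGadgetUWA1OBlockIQ8
import Summits.Ventures.PercRepro2.CaseOneGadgetUWA1OBlockIQ9
import Summits.Ventures.PercRepro2.CaseOneGadgetUWA1OBlockIQ10
import Summits.Ventures.PercRepro2.CaseOneGadgetUWA1OBlockIQ11
import Summits.Ventures.PercRepro2.CaseOneGadgetUWA1OBlockIQ12
import Summits.Ventures.PercRepro2.CaseOneGadgetUWA1OBlockIQ13
import Summits.Ventures.PercRepro2.CaseOneGadgetUWA1OBlockIQ14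

/-!
# The gadget `u ~ {w, a₁, o}`, `w ~ {u, a₂, b}` (uwa1o): the cell certificates of `iqAO5` (part 35e)
(blind cell PercRepro2, p1 g34; the fourth gadget anchor of the six-form calculus — all six forms of the uwa1o gadget
as plain SFacts-cone certificate chains, generated by mining/p1/g34/uwa1o/genu.py = p1 g33's gent_uwa1.py / g25's
geno.py re-targeted; P1-G33 §6–§6″, P1-G34)

Each `eBAOIQ ijk kl` is a nonnegative combination of `(pairwise atom) × (cell)` and cubic cell monomials — or, for the degree-4 ones, `M × eBAOIQ ijk kl` (`M = Σ cᵢ` the total cell mass) is a nonnegative combination of `(atom) × (cell) × (cell)` and quartic cell monomials, then `SFacts.nonneg_of_sum_mul` (`CaseOneStarCertT1`) — exact LP certificates (kit j319447, every certificate re-verified exactly; data/p1/g33/gcerts_i_uwa1o.json, form `i-Q`), here as exact `linear_combination`s over `SFacts` (the rational coefficients cleared by their common denominator). -/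

namespace Summit.Ventures.PercRepro2

namespace CaseOne

section CertAOIQ35e
variable {R : Type*} [Field R] [LinearOrder R] [IsStrictOrderedRing R]

set_option maxHeartbeats 0 in
/-- `eBAOIQ33231 ≥ 0`: the combination is identically zero (`ring`). -/
lemma eBAOIQ33231_nonneg (m : SCells R) (_hf : SFacts m) : 0 ≤ eBAOIQ33231 m := by
  have h : eBAOIQ33231 m = 0 := by
    unfold eBAOIQ33231 cBAOIQ00131 cBAOIQ01031 cBAOIQ01131 cBAOIQ01231 cBAOIQ02131 cBAOIQ02231 cBAOIQ03231 cBAOIQ10131 cBAOIQ10231 cBAOIQ11031 cBAOIQ11131 cBAOIQ11231 cBAOIQ12031 cBAOIQ12131 cBAOIQ12231 cBAOIQ13131 cBAOIQ13231 cBAOIQ20231 cBAOIQ21131 cBAOIQ21231 cBAOIQ22031 cBAOIQ22131 cBAOIQ22231 cBAOIQ23031 cBAOIQ23131 cBAOIQ23231 cBAOIQ31231 cBAOIQ32131 cBAOIQ32231 cBAOIQ33031 cBAOIQ33131 cBAOIQ33231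
    ring
  linarith [h]

end CertAOIQ35e

end CaseOne

end Summit.Ventures.PercRepro2
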